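import Mathlib
import Literature.Analysis.Complex.LogDerivZeros

/-!
# RiemannHypothesis / UniversalFactor — dividing out finitely many zeros of an entire function (route-file-independent)

Route `RiemannHypothesis/UniversalFactor`, item `WideKernelNoGo` (stmt-RiemannHypothesis-2578). Generic
complex-analysis lemmas used by the wide-kernel no-go theorem, in a module that imports neither the
route file nor any module importing it (see `UniversalFactorH0DecayStandalone.lean` for why; these
are, up to cosmetic restatement, the `UniversalFactor.*` lemmas of
`UniversalFactorWideKernelNoGo.lean`, which imports the route file and therefore cannot be used by a
closing module):

* `UniversalFactorStandalone.exists_zeroFree_factor` — an entire `f` with `f(0) ≠ 0` and all zeros in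
  `‖z‖ < R` factors as `f = P · G`, `P(z) = ∏_{a ∈ S}(z − a)^{m(a)}` (roots = zeros of `f`), `G` entire
  and zero-free on `ℂ` (the tree's `exists_finset_zeros_eq_prod_mul` — Mathlib's
  `MeromorphicOn.extract_zeros_poles` — on the ball, glued with `f/P` outside it);
* `UniversalFactorStandalone.im_factor_ofReal_eq_zero` — `G` is real on `ℝ` when `f` is and the roots
  are real; `UniversalFactorStandalone.exists_growth_factor` — `G` inherits `‖·‖ ≤ C e^{‖z‖^ρ}`;
  `UniversalFactorStandalone.norm_prod_pow_sub_le_pow` — `‖P(z)‖ ≤ (‖z‖ + R)^{deg P}`;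
* `UniversalFactorStandalone.false_of_exp_le_pow` — `κe^{y} ≤ K(y + R)^N` for all `y ≥ 0`, `κ > 0`,
  is absurd.

References: E. C. Titchmarsh, *The theory of functions* (1939), §3.1 (isolated zeros), §8.1;
folklore.
-/

noncomputable section

namespace Summit.RiemannHypothesis.RiemannHypothesis.Theorems

open MeasureTheory Set Filter Metric Complex
open scoped Topology
open Literature.Analysis.Complex

/-! ## Dividing an entire function by all of its (finitely many) zeros -/

/-- **Global extraction of finitely many zeros.** If `f` is entire, `f(0) ≠ 0` and every zero of
`f` lies in the open ball `‖z‖ < R`, then `f = P · G` with `P(z) = ∏_{a ∈ S} (z − a)^{m(a)}` a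
polynomial whose roots are zeros of `f`, and `G` entire and zero-free on all of `ℂ`.
(The tree's `exists_finset_zeros_eq_prod_mul` — Mathlib's `MeromorphicOn.extract_zeros_poles` — on
the ball, glued with `f/P` outside it.) [folklore] -/
theorem UniversalFactorStandalone.exists_zeroFree_factor {f : ℂ → ℂ} (hf : Differentiable ℂ f)
    (h0 : f 0 ≠ 0) {R : ℝ} (hR : ∀ z, f z = 0 → ‖z‖ < R) :
    ∃ (S : Finset ℂ) (m : ℂ → ℕ) (G : ℂ → ℂ),
      (∀ a ∈ S, f a = 0) ∧ (∀ a ∈ S, ‖a‖ < R) ∧ Differentiable ℂ G ∧ (∀ z, G z ≠ 0) ∧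
      ∀ z, f z = (∏ a ∈ S, (z - a) ^ m a) * G z := by
  obtain ⟨S, m, g, hS, hS', hgd, hg0, hfg⟩ := exists_finset_zeros_eq_prod_mul hf (c := 0) h0 R
  classical
  set P : ℂ → ℂ := fun z ↦ ∏ a ∈ S, (z - a) ^ m a with hP
  set G : ℂ → ℂ := fun z ↦ if ‖z‖ < R then g z else f z / P z with hG
  have hball : ∀ z : ℂ, z ∈ ball (0 : ℂ) R ↔ ‖z‖ < R := fun z ↦ by
    rw [mem_ball, dist_zero_right]
  have hSball : ∀ a ∈ S, ‖a‖ < R := fun a ha ↦ (hball a).1 (hS a ha).2.2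
  -- `P ≠ 0` off `S`
  have hPne : ∀ z, z ∉ S → P z ≠ 0 := fun z hz ↦
    prod_pow_sub_ne_zero m fun a ha h ↦ hz (h ▸ ha)
  -- off `S`, `G = f / P`
  have hGeq : ∀ z, z ∉ S → G z = f z / P z := by
    intro z hz
    by_cases hzR : ‖z‖ < R
    · have h1 : G z = g z := by simp [hG, hzR]
      rw [h1, eq_div_iff (hPne z hz), hfg z ((hball z).2 hzR)]
      simp only [hP]
      ring
    · simp [hG, hzR]
  -- inside the ball, `G = g`
  have hGin : ∀ z, ‖z‖ < R → G z = g z := fun z hz ↦ by simp [hG, hz]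
  refine ⟨S, m, G, fun a ha ↦ (hS a ha).1, hSball, ?_, ?_, ?_⟩
  · -- differentiability
    intro z
    by_cases hzR : ‖z‖ < R
    · have hz : z ∈ ball (0 : ℂ) R := (hball z).2 hzR
      have hev : G =ᶠ[𝓝 z] g := by
        filter_upwards [isOpen_ball.mem_nhds hz] with w hw
        exact hGin w ((hball w).1 hw)
      exact (hev.differentiableAt_iff).2 (hgd.differentiableAt (isOpen_ball.mem_nhds hz))
    · have hzS : z ∉ S := fun h ↦ hzR (hSball z h)
      have hopen : IsOpen ((S : Set ℂ)ᶜ) := S.finite_toSet.isClosed.isOpen_compl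
      have hev : G =ᶠ[𝓝 z] fun w ↦ f w / P w := by
        filter_upwards [hopen.mem_nhds (show z ∈ ((S : Set ℂ)ᶜ) from hzS)] with w hw
        exact hGeq w hw
      refine (hev.differentiableAt_iff).2 ?_
      exact ((hf z).div ((differentiable_prod_pow_sub S m) z) (hPne z hzS))
  · -- zero-free
    intro z
    by_cases hzR : ‖z‖ < R
    · rw [hGin z hzR]; exact hg0 z ((hball z).2 hzR)
    · have hzS : z ∉ S := fun h ↦ hzR (hSball z h)
      have hfz : f z ≠ 0 := fun h ↦ hzR (hR z h)
      rw [hGeq z hzS]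
      exact div_ne_zero hfz (hPne z hzS)
  · -- the factorisation
    intro z
    by_cases hzR : ‖z‖ < R
    · rw [hGin z hzR]; exact hfg z ((hball z).2 hzR)
    · have hzS : z ∉ S := fun h ↦ hzR (hSball z h)
      have hPz := hPne z hzS
      rw [hGeq z hzS]
      simp only [hP] at hPz ⊢
      field_simp


/-- If `f = P · G` with `P(z) = ∏_{a ∈ S} (z − a)^{m(a)}`, all `a ∈ S` real, `f` real on `ℝ` and `G`
entire, then `G` is real on `ℝ` (off the finite set `S` it is a quotient of reals; on `S` by
continuity and density). [folklore] -/
theorem UniversalFactorStandalone.im_factor_ofReal_eq_zero (x : ℝ) {f G : ℂ → ℂ} {S : Finset ℂ}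
    {m : ℂ → ℕ} (hG : Differentiable ℂ G) (hfac : ∀ z, f z = (∏ a ∈ S, (z - a) ^ m a) * G z)
    (hreal : ∀ x : ℝ, (f x).im = 0) (hS : ∀ a ∈ S, a.im = 0) : (G x).im = 0 := by
  classical
  -- the polynomial is real at real points
  have hPreal : ∀ x : ℝ, (∏ a ∈ S, ((x : ℂ) - a) ^ m a) =
      ((∏ a ∈ S, (x - a.re) ^ m a : ℝ) : ℂ) := by
    intro x
    push_cast
    refine Finset.prod_congr rfl fun a ha ↦ ?_
    congr 1
    apply Complex.ext <;> simp [hS a ha]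
  -- off `S`, `G x` is real
  have hoff : ∀ x : ℝ, (x : ℂ) ∉ S → (G x).im = 0 := by
    intro x hx
    have hPne : (∏ a ∈ S, ((x : ℂ) - a) ^ m a) ≠ 0 :=
      prod_pow_sub_ne_zero m fun a ha h ↦ hx (h ▸ ha)
    have hGx : G x = f x / ∏ a ∈ S, ((x : ℂ) - a) ^ m a := by
      rw [hfac x]; field_simp
    have hfx : f x = ((f x).re : ℂ) := Complex.ext (by simp) (by simp [hreal x])
    rw [hGx, hPreal x, hfx, ← Complex.ofReal_div, Complex.ofReal_im]
  -- the exceptional set is finite, so its complement is dense; conclude by continuity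
  set T : Set ℝ := ((↑) : ℝ → ℂ) ⁻¹' (S : Set ℂ) with hT
  have hTfin : T.Finite := S.finite_toSet.preimage Complex.ofReal_injective.injOn
  have hdense : Dense Tᶜ := hTfin.countable.dense_compl ℝ
  have hcont : Continuous fun x : ℝ ↦ (G x).im :=
    Complex.continuous_im.comp (hG.continuous.comp Complex.continuous_ofReal)
  have h := Continuous.ext_on hdense hcont continuous_const fun x hx ↦ hoff x hx
  exact congrFun h x

/-- If `f = P · G` as above with `‖f(z)‖ ≤ C e^{‖z‖^ρ}` and the roots of `P` in `‖a‖ < R`, then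
`‖G(z)‖ ≤ C' e^{‖z‖^ρ}`: far from the roots `‖P‖ ≥ 1`, near them `G` is bounded. [folklore] -/
theorem UniversalFactorStandalone.exists_growth_factor {f G : ℂ → ℂ} {S : Finset ℂ} {m : ℂ → ℕ}
    {ρ C R : ℝ} (hG : Differentiable ℂ G) (hfac : ∀ z, f z = (∏ a ∈ S, (z - a) ^ m a) * G z)
    (hgr : ∀ z, ‖f z‖ ≤ C * Real.exp (‖z‖ ^ ρ)) (hS : ∀ a ∈ S, ‖a‖ < R) :
    ∃ C' : ℝ, 0 ≤ C' ∧ ∀ z, ‖G z‖ ≤ C' * Real.exp (‖z‖ ^ ρ) := by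
  classical
  obtain ⟨M, hM⟩ := (isCompact_closedBall (0 : ℂ) (R + 1)).exists_bound_of_continuousOn
    hG.continuous.continuousOn
  refine ⟨max C 0 + max M 0, by positivity, fun z ↦ ?_⟩
  have hexp1 : 1 ≤ Real.exp (‖z‖ ^ ρ) := Real.one_le_exp (Real.rpow_nonneg (norm_nonneg z) ρ)
  rcases le_or_gt ‖z‖ (R + 1) with hz | hz
  · have h1 : ‖G z‖ ≤ M := hM z (mem_closedBall_zero_iff.2 hz)
    calc ‖G z‖ ≤ max M 0 * 1 := by rw [mul_one]; exact h1.trans (le_max_left _ _)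
      _ ≤ (max C 0 + max M 0) * Real.exp (‖z‖ ^ ρ) :=
          mul_le_mul (le_add_of_nonneg_left (le_max_right _ _)) hexp1 zero_le_one (by positivity)
  · have hP1 : 1 ≤ ‖∏ a ∈ S, (z - a) ^ m a‖ := by
      rw [norm_prod]
      refine Finset.prod_induction _ (fun x : ℝ ↦ 1 ≤ x)
        (fun x y hx hy ↦ one_le_mul_of_one_le_of_one_le hx hy) le_rfl fun a ha ↦ ?_
      rw [norm_pow]
      refine one_le_pow₀ ?_
      have h1 : ‖z‖ ≤ ‖z - a‖ + ‖a‖ := norm_le_norm_sub_add z a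
      linarith [hS a ha]
    have h2 : ‖f z‖ = ‖∏ a ∈ S, (z - a) ^ m a‖ * ‖G z‖ := by rw [hfac z, norm_mul]
    calc ‖G z‖ ≤ ‖∏ a ∈ S, (z - a) ^ m a‖ * ‖G z‖ := le_mul_of_one_le_left (norm_nonneg _) hP1
      _ = ‖f z‖ := h2.symm
      _ ≤ C * Real.exp (‖z‖ ^ ρ) := hgr z
      _ ≤ (max C 0 + max M 0) * Real.exp (‖z‖ ^ ρ) := by
          gcongr
          exact (le_max_left _ _).trans (le_add_of_nonneg_right (le_max_right _ _))

/-- `‖∏_{a ∈ S} (z − a)^{m(a)}‖ ≤ (‖z‖ + R)^{∑ m(a)}` when all `‖a‖ < R`. [folklore] -/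
theorem UniversalFactorStandalone.norm_prod_pow_sub_le_pow {S : Finset ℂ} (m : ℂ → ℕ) {R : ℝ}
    (hS : ∀ a ∈ S, ‖a‖ ≤ R) (z : ℂ) :
    ‖∏ a ∈ S, (z - a) ^ m a‖ ≤ (‖z‖ + R) ^ (∑ a ∈ S, m a) := by
  classical
  rw [norm_prod, ← Finset.prod_pow_eq_pow_sum]
  refine Finset.prod_le_prod (fun a _ ↦ norm_nonneg _) fun a ha ↦ ?_
  rw [norm_pow]
  refine pow_le_pow_left₀ (norm_nonneg _) ?_ _
  calc ‖z - a‖ ≤ ‖z‖ + ‖a‖ := norm_sub_le _ _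
    _ ≤ ‖z‖ + R := by linarith [hS a ha]

/-- An exponential lower bound and a polynomial upper bound are incompatible:
`κ e^{y} ≤ K (y + R)^N` for all `y ≥ 0` with `κ > 0` is absurd. [folklore] -/
theorem UniversalFactorStandalone.false_of_exp_le_pow {κ K R : ℝ} {N : ℕ}
    (h : ∀ y : ℝ, 0 ≤ y → κ * Real.exp y ≤ K * (y + R) ^ N) (hκ : 0 < κ) : False := by
  have h1 : Tendsto (fun y : ℝ ↦ (y + R) ^ N * Real.exp (-(y + R))) atTop (𝓝 0) :=
    (Real.tendsto_pow_mul_exp_neg_atTop_nhds_zero N).comp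
      (tendsto_atTop_add_const_right _ _ tendsto_id)
  have h2 : Tendsto (fun y : ℝ ↦ K * Real.exp R * ((y + R) ^ N * Real.exp (-(y + R)))) atTop
      (𝓝 (K * Real.exp R * 0)) := h1.const_mul _
  rw [mul_zero] at h2
  obtain ⟨y, hy, hy0⟩ := ((h2.eventually_lt_const hκ).and (eventually_ge_atTop 0)).exists
  have h3 := h y hy0
  have key : K * Real.exp R * ((y + R) ^ N * Real.exp (-(y + R))) =
      K * (y + R) ^ N * (Real.exp y)⁻¹ := by
    rw [neg_add, Real.exp_add, Real.exp_neg, Real.exp_neg]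
    field_simp
  rw [key] at hy
  have h4 : κ ≤ K * (y + R) ^ N * (Real.exp y)⁻¹ := by
    rw [← div_eq_mul_inv, le_div_iff₀ (Real.exp_pos y)]; exact h3
  linarith

end Summit.RiemannHypothesis.RiemannHypothesis.Theorems
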